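/-
Copyright (c) 2026 the pub-hodgecm-mathlib formalisation cell (harness21).  Prover seat hodgecm-mathlib-K2E1-p16 (g2), Track B «K2-LIT» ENGINE E1, h413 =
`stmt-HodgeConjecture-24833`, route `HCCMUnconditional`; R90-TF section S8 «ContSpec-n½» (dealer R90-CS-plan (g0), LEAD K2E1-plan (g7)), «U(Φ₃) χ-TWIN #1» dealt BY NAME
16:06:43Z: the N = 3 twin of ★ `K2E1ChiConvDataCMTwo.exists_chi_convData_cm_two` (K2E1-p14 (g0)) over the ★ U3 spherical supplier `K2E1SphericalEisensteinMeromorphicConvDataCMThree`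
(K2E2-p12 (g5)) — substitution `2 ↦ 3`, `GL (Fin 2) ↦ GL (Fin 3)`, `HX … 2 (n+3) ↦ HX … 3 (n+4)`, `iotaBound_cm ↦ iotaBound_cm_three`, suppliers `…_cm ↦ …_cm_three`; proof verbatim.
-/
import Summits.HodgeConjecture.HodgeConjecture.Theorems.K2E1SphericalEisensteinMeromorphicConvDataCMThree   -- ★ p859232-lineage (K2E2-p12 g5): the SPHERICAL N = 3 template `exists_convData_cm_three`; brings ★ ι₃ `iotaBound_cm_three`, ★ Suppliers₃ `exists_pos_forall_measure_setOf_lt_ne_zero_cm_three`, ★ rank-generic `exists_heckePackage'`, `exists_levels`, `continuous_lift`, `hasCompactSupport_lift`, ★ `K2E1BLSelfConvolutionU2`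
import Summits.HodgeConjecture.HodgeConjecture.Theorems.K2E1BorelEisensteinUDefs                            -- ★ `flatSectionU` (rank-generic)
import HarnessLib

/-!
# h413 ∕ Track B «K2-LIT», S8 «U(Φ₃) χ-TWIN #1» — `K2E1ChiConvDataCMThree`: THE BALL DATA OF THE (χ,τ) BERNSTEIN–LAPID SYSTEM OF `U(2,1)_{L∕L⁺} = U(Φ₃)` (the N = 3 TWIN of ★ `K2E1ChiConvDataCMTwo`) — finitely many self-convolution test
# functions acting on the section space by ENTIRE SCALARS `ŝ_i(z)` that cover the ball, one of them non-constant, with the `ShiftBound` ∕ Hecke-package ∕ level bookkeeping of ★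
# `exists_convData_cm_three` redone for them (hypothesis-first on the arch-only scalar-action letter, as at N = 2)

Cell `pub/hodgecm-mathlib`, crux H413 = `stmt-HodgeConjecture-24833`; dealer R90-CS-plan (g0) (S8 «U(Φ₃) χ-TWIN #1», 2026-09-04T16:06:43Z; p14 census `CENSUS-S8-contU2.md` 52c5c0ffcf668495 §3 (i)).  THEOREMS ONLY (no `def`, no `instance`, no `notation`, no named-fact hypothesis, no `sorry`);
lane `--kind proof --supports stmt-HodgeConjecture-24833 --as helper` (count-neutral).  The CM pair `(L⁺, L, conj)`, `N = 3` — EVERY token below is the N = 2 original's with `2 ↦ 3`, `GL (Fin 3) ↦ GL (Fin 3)`, the Sobolev exponent `n + 3 ↦ n + 4` of the ★ U3 supplier, `iotaBound_cm ↦ iotaBound_cm_three` (★ `K2E1BLIotaClosedEmbeddingU3`), `exists_pos_iota_closedEmbedding_cm ↦ …_cm_three`, `exists_pos_forall_measure_setOf_lt_ne_zero_cm ↦ …_cm_three` (★ `K2E1SphericalEisensteinMeromorphicSuppliersU3`); the rank-generic bricks (`exists_heckePackage′`, `exists_levels`, `continuous_lift`, `hasCompactSupport_lift`, `measurePreserving_rightShift_of_unfolding`,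 `exists_finset_forall_exists_ne_zero_closedBall`, ★ `K2E1BLSelfConvolutionU2`, `flatSectionU`) are used AS IS; the proof is the N = 2 proof verbatim.

THE MATHEMATICS [BernsteinLapid2019, §4 Claims 4–5 and p. 10; MoeglinWaldspurger1995, IV.1.9].  ★ `exists_convData_cm_three` (as ★ `exists_convData_cm_two`) builds the ball data of the SPHERICAL system from bi-`K`-invariant
`GL₃`-test functions `η` with `η̂(z₀) ≠ 0` (★ `exists_symm_isTestFunctionGL_biInvariant_integral_ne_zero`): `h := S_η η = ∫ η̃(g)η̃(g⁻¹·) dν_G` acts on `H^z` by the SPHERICAL TRANSFORM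
`ĥ(z) = η̂(z)²`, finitely many cover the ball, and the ★ generic bricks (`exists_heckePackage′`, `exists_pos_iota_closedEmbedding_cm`, `exists_pos_forall_measure_setOf_lt_ne_zero_cm`,
`exists_levels`, the self-convolution facts, K1 — all test-function-SHAPE-INDEPENDENT: they need only `η` a `GL₃`-test function and `h = S_η η ∈ C_c`) supply
`ShiftBound`, the `𝔛`-operators `T_i` with their convolution formula and intertwining, the levels and the ι-package.  For a `(χ,τ)`-SECTION SPACE `V = V(χ, K′, ω)` the right convolution by an
ARCHIMEDEAN-ONLY pure tensor `h = h_∞ ⊗ 𝟙_U` with `K_∞`-central `h_∞` acts on `V ⊗ H^z` by a SCALAR `s(z)` (★ 12d-C `exists_rightConvSection_eq_smul_of_arch`, K2-defs1), entire in `z`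
(★ row 10 `differentiable_rightConvSection_apply`) — CURRENCY NOTE: `s` is the `(χ_∞, ω)`-spherical transform of `h_∞`, NOT the spherical transform `ĥ(z) = ∫ h·H^z` unless `χ_∞ = 1 = ω`
(an arch twist `∏_w|·|_w^{it_w}`, `Σt_w = 0`, or a non-trivial `K_∞`-type already separate them) — so the (χ,τ) ball system must carry the eigenvalue FUNCTIONS `ŝ_i` (★ 11b
`exists_xSystem_finDim` is generic in them).  THIS FILE, HYPOTHESIS-FIRST on that letter (per point `z₀` a symmetric non-negative `GL₃`-test function `η` and an ENTIRE `s` with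
`s(z₀) ≠ 0` and `R(S_η η) f_z^φ = s(z)·f_z^φ` for all `φ ∈ V`, all `z`; plus ONE member with NON-CONSTANT `s` — the `hnc` letter behind `hsep`, ★ 12c §1), proves
**`exists_chi_convData_cm_three`**: `∃ a > 0, I finite, i₀, η, κ, T, ŝ` with — the `η_i` smooth non-negative symmetric; the `h_i = S_{η_i}η_i` continuous, compactly supported, symmetric, real,
`Re ≥ 0` (★ self-convolution facts); `ŝ_i` ENTIRE with the scalar action `∫ h_i(y) f_z^φ(x y) dν_G(y) = ŝ_i(z)·f_z^φ(x)` on `V`; the COVER `∀ z ∈ ball 0 (n+2), ∃ i, ŝ_i(z) ≠ 0` (finitely many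
members by continuity of the entire `ŝ` on the closed ball, ★ `exists_finset_forall_exists_ne_zero_closedBall`); `ŝ_{i₀}` NON-CONSTANT, hence `≠ 0` somewhere in the ball (identity
principle); and VERBATIM ★'s level ∕ comparison ∕ ι-package ∕ `μZ(Z_a) ≠ 0` ∕ `T_i`-formula ∕ `ShiftBound`-intertwining clauses.  Consumers: the GENERIC-EIGENVALUE editions of the (χ,τ)
12-block (12b, hunq_χ, X1_χ, X2_χ) — `ŝ i z` in place of `∫ h_i·H^z` — at N = 3 (twins #2–#8 of the S8 TWIN-DAG).
HONEST LABEL: HC_CM is proved only modulo the 7 printed citations (2 remaining named inputs: hLiu418 = `stmt-HodgeConjecture-24832`, h413 = `stmt-HodgeConjecture-24833`) until rung 0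
closes; this file asserts no named fact and closes no socket; the letters `hfam`∕`hnc` (arch-only scalar action with prescribed non-vanishing ∕ non-constancy) are NOT proved here.

## References
* [BernsteinLapid2019] J. Bernstein, E. Lapid, *On the meromorphic continuation of Eisenstein series*, J. Amer. Math. Soc. 37 (2024) (arXiv:1911.02342), §4 Claims 4–5, p. 10.
* [MoeglinWaldspurger1995] C. Mœglin, J.-L. Waldspurger, *Spectral Decomposition and Eisenstein Series* (1995), IV.1.9 (the operators `T_i` and the finite cover).
-/

set_option autoImplicit false
-- the mandated namespace repeats the single-problem summit's segment (`HodgeConjecture.HodgeConjecture`)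
set_option linter.dupNamespace false

noncomputable section

open MeasureTheory Measure Filter Topology Set NumberField
open scoped NNReal ENNReal ComplexConjugate
open Literature.MeasureTheory.Group Literature.NumberTheory Literature.NumberTheory.Automorphic Literature.NumberTheory.Automorphic.UnitaryGroup AdelicGroupData
open Summit.HodgeConjecture.HodgeConjecture.Cruxes.H413.K2E1BorelEisensteinU
open Summit.HodgeConjecture.HodgeConjecture.Cruxes.H413.K2E1BLBorelSpacesU2Defs
open Summit.HodgeConjecture.HodgeConjecture.Cruxes.H413.K2E1BLBorelOperatorsU2Defs
open Summit.HodgeConjecture.HodgeConjecture.Cruxes.H413.K2E1BLIotaClosedEmbeddingU3 (iotaBound_cm_three exists_pos_iota_closedEmbedding_cm_three)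
open Summit.HodgeConjecture.HodgeConjecture.Cruxes.H413.K2E1BLQuotientMeasureU (measurePreserving_rightShift_of_unfolding)
open Summit.HodgeConjecture.HodgeConjecture.Cruxes.H413.K2E1BLMeromorphicGluing (exists_finset_forall_exists_ne_zero_closedBall)
open Summit.HodgeConjecture.HodgeConjecture.Cruxes.H413.K2E1SphericalEisensteinMeromorphicSuppliersU2 (exists_heckePackage')
open Summit.HodgeConjecture.HodgeConjecture.Cruxes.H413.K2E1SphericalEisensteinMeromorphicSuppliersU3 (exists_pos_forall_measure_setOf_lt_ne_zero_cm_three)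
open Summit.HodgeConjecture.HodgeConjecture.Cruxes.H413.K2E1SphericalEisensteinMeromorphicBallDataCMTwo (exists_levels continuous_lift hasCompactSupport_lift)
open Summit.HodgeConjecture.HodgeConjecture.Cruxes.H413.K2E1BLSelfConvolutionU2

namespace Summit.HodgeConjecture.HodgeConjecture.Cruxes.H413.K2E1ChiConvDataCMThree

variable (L : Type) [Field L] [NumberField L] [IsCMField L]
  [MeasurableSpace (quasiSplit (↥(maximalRealSubfield L)) L (IsCMField.complexConj L) 3).Adelic] [BorelSpace (quasiSplit (↥(maximalRealSubfield L)) L (IsCMField.complexConj L) 3).Adelic]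

/-- **THE BALL DATA OF THE (χ,τ) SYSTEM WITH SELF-CONVOLUTION TEST FUNCTIONS AND ENTIRE EIGENVALUE FUNCTIONS `ŝ_i`** (module docstring): from the arch-only scalar-action letters `hfam`
(non-vanishing at each prescribed point) and `hnc` (one non-constant member), ball by ball the data `a, I, i₀, η, κ, T, ŝ` with ★ `exists_convData_cm_three`'s generic clauses verbatim (N = 3 twin of ★ `exists_chi_convData_cm_two`) and
the (χ,τ) clauses: `ŝ_i` entire, `R(h_i) f_z^φ = ŝ_i(z) f_z^φ` on `V`, the cover of `ball 0 (n+2)` by `{ŝ_i ≠ 0}`, `ŝ_{i₀}` non-constant and `≠ 0` somewhere in the ball.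
[cite: BernsteinLapid2019, §4 Claims 4–5 and p. 10] [cite: MoeglinWaldspurger1995, IV.1.9] -/
theorem exists_chi_convData_cm_three
    (μ : Measure (quasiSplit (↥(maximalRealSubfield L)) L (IsCMField.complexConj L) 3).automorphicQuotient)
    [(quasiSplit (↥(maximalRealSubfield L)) L (IsCMField.complexConj L) 3).IsAutomorphicMeasure μ]
    (νG : Measure (quasiSplit (↥(maximalRealSubfield L)) L (IsCMField.complexConj L) 3).Adelic) [νG.IsHaarMeasure] [νG.IsInvInvariant] [SFinite νG]
    {β : (quasiSplit (↥(maximalRealSubfield L)) L (IsCMField.complexConj L) 3).Adelic → ℝ≥0∞}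
    (hβ : IsCoveringWeight ↥((arithmeticBorel (↥(maximalRealSubfield L)) L (IsCMField.complexConj L) 3).map
      (quasiSplit (↥(maximalRealSubfield L)) L (IsCMField.complexConj L) 3).arithmeticSubgroup.subtype) β)
    {μZ : Measure (borelQuotient (↥(maximalRealSubfield L)) L (IsCMField.complexConj L) 3)} [SFinite μZ]
    (hμZ : ∀ f : borelQuotient (↥(maximalRealSubfield L)) L (IsCMField.complexConj L) 3 → ℝ≥0∞, Measurable f →
      ∫⁻ z, f z ∂μZ = ∫⁻ g, β g * f (toBorelQuotient (↥(maximalRealSubfield L)) L (IsCMField.complexConj L) 3 g) ∂νG)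
    -- THE (χ,τ) LETTERS: the section space and the family of symmetric non-negative GL₂-test functions whose self-convolutions act on `V ⊗ H^z` by ENTIRE scalars, non-vanishing at a
    -- prescribed point (payer: ★ 12d-C ∘ ★ row 10 holomorphy ∘ an approximate identity), plus ONE member with a NON-CONSTANT scalar (the `hnc` letter, feeds `hsep`)
    (V : Submodule ℂ ((quasiSplit (↥(maximalRealSubfield L)) L (IsCMField.complexConj L) 3).Adelic → ℂ))
    (hfam : ∀ z₀ : ℂ, ∃ η : GL (Fin 3) (AdeleRing (𝓞 L) L) → ℝ, IsTestFunctionGL 3 L η ∧ (∀ g, 0 ≤ η g) ∧ (∀ g, η g⁻¹ = η g) ∧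
      ∃ s : ℂ → ℂ, Differentiable ℂ s ∧ s z₀ ≠ 0 ∧ ∀ z : ℂ, ∀ φ ∈ V, ∀ x : (quasiSplit (↥(maximalRealSubfield L)) L (IsCMField.complexConj L) 3).Adelic, (∫ y, (fun y : (quasiSplit (↥(maximalRealSubfield L)) L (IsCMField.complexConj L) 3).Adelic => orbitalSmoothing νG (fun x : (quasiSplit (↥(maximalRealSubfield L)) L (IsCMField.complexConj L) 3).Adelic => ((η (adelicVal (↥(maximalRealSubfield L)) L (IsCMField.complexConj L) 3 ((StdForm.antidiagonal 3).over L) x) : ℝ) : ℂ)) (fun x : (quasiSplit (↥(maximalRealSubfield L)) L (IsCMField.complexConj L) 3).Adelic => ((η (adelicVal (↥(maximalRealSubfield L)) L (IsCMField.complexConj L) 3 ((StdForm.antidiagonal 3).over L) x) : ℝ) : ℂ)) y) y * flatSectionU φ z (x * y) ∂νG) = s z * flatSectionU φ z x)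
    (hnc : ∃ η : GL (Fin 3) (AdeleRing (𝓞 L) L) → ℝ, IsTestFunctionGL 3 L η ∧ (∀ g, 0 ≤ η g) ∧ (∀ g, η g⁻¹ = η g) ∧
      ∃ s : ℂ → ℂ, Differentiable ℂ s ∧ (∃ z₁ z₂ : ℂ, s z₁ ≠ s z₂) ∧ ∀ z : ℂ, ∀ φ ∈ V, ∀ x : (quasiSplit (↥(maximalRealSubfield L)) L (IsCMField.complexConj L) 3).Adelic, (∫ y, (fun y : (quasiSplit (↥(maximalRealSubfield L)) L (IsCMField.complexConj L) 3).Adelic => orbitalSmoothing νG (fun x : (quasiSplit (↥(maximalRealSubfield L)) L (IsCMField.complexConj L) 3).Adelic => ((η (adelicVal (↥(maximalRealSubfield L)) L (IsCMField.complexConj L) 3 ((StdForm.antidiagonal 3).over L) x) : ℝ) : ℂ)) (fun x : (quasiSplit (↥(maximalRealSubfield L)) L (IsCMField.complexConj L) 3).Adelic => ((η (adelicVal (↥(maximalRealSubfield L)) L (IsCMField.complexConj L) 3 ((StdForm.antidiagonal 3).over L) x) : ℝ) : ℂ)) y) y * flatSectionU φ z (x * y) ∂νG) = s z * flatSectionU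 φ z x)
    (n : ℕ) :
    ∃ (a : ℝ≥0) (ha : 0 < a) (I : Type) (_ : Fintype I) (i₀ : I) (η : I → GL (Fin 3) (AdeleRing (𝓞 L) L) → ℝ) (κ : I → ℝ≥0)
      (T : I → HX (↥(maximalRealSubfield L)) L (IsCMField.complexConj L) 3 (n + 4) μ →L[ℂ] HX (↥(maximalRealSubfield L)) L (IsCMField.complexConj L) 3 (n + 4) μ) (ŝ : I → ℂ → ℂ),
      -- the test functions `η_i` (smooth, non-negative, symmetric) and the self-convolutions `h_i = S_{η_i} η_i` (continuous, compactly supported, symmetric, real, `Re ≥ 0`)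
      (∀ i, IsTestFunctionGL 3 L (η i) ∧ (∀ g, 0 ≤ η i g) ∧ (∀ g, η i g⁻¹ = η i g)) ∧
      (∀ i, Continuous (fun y : (quasiSplit (↥(maximalRealSubfield L)) L (IsCMField.complexConj L) 3).Adelic => orbitalSmoothing νG (fun x : (quasiSplit (↥(maximalRealSubfield L)) L (IsCMField.complexConj L) 3).Adelic => ((η i (adelicVal (↥(maximalRealSubfield L)) L (IsCMField.complexConj L) 3 ((StdForm.antidiagonal 3).over L) x) : ℝ) : ℂ)) (fun x : (quasiSplit (↥(maximalRealSubfield L)) L (IsCMField.complexConj L) 3).Adelic => ((η i (adelicVal (↥(maximalRealSubfield L)) L (IsCMField.complexConj L) 3 ((StdForm.antidiagonal 3).over L) x) : ℝ) : ℂ)) y) ∧ HasCompactSupport (fun y : (quasiSplit (↥(maximalRealSubfield L)) L (IsCMField.complexConj L) 3).Adelic => orbitalSmoothing νG (fun x : (quasiSplit (↥(maximalRealSubfield L)) L (IsCMField.complexConj L) 3).Adelic => ((η i (adelicVal (↥(maximalRealSubfield L)) L (IsCMField.complexConj L) 3 ((StdForm.antidiagonal 3).over L) x) : ℝ) : ℂ))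 (fun x : (quasiSplit (↥(maximalRealSubfield L)) L (IsCMField.complexConj L) 3).Adelic => ((η i (adelicVal (↥(maximalRealSubfield L)) L (IsCMField.complexConj L) 3 ((StdForm.antidiagonal 3).over L) x) : ℝ) : ℂ)) y) ∧
        (∀ g, (fun y : (quasiSplit (↥(maximalRealSubfield L)) L (IsCMField.complexConj L) 3).Adelic => orbitalSmoothing νG (fun x : (quasiSplit (↥(maximalRealSubfield L)) L (IsCMField.complexConj L) 3).Adelic => ((η i (adelicVal (↥(maximalRealSubfield L)) L (IsCMField.complexConj L) 3 ((StdForm.antidiagonal 3).over L) x) : ℝ) : ℂ)) (fun x : (quasiSplit (↥(maximalRealSubfield L)) L (IsCMField.complexConj L) 3).Adelic => ((η i (adelicVal (↥(maximalRealSubfield L)) L (IsCMField.complexConj L) 3 ((StdForm.antidiagonal 3).over L) x) : ℝ) : ℂ)) y) g⁻¹ = (fun y : (quasiSplit (↥(maximalRealSubfield L)) L (IsCMField.complexConj L) 3).Adelic => orbitalSmoothing νG (fun x : (quasiSplit (↥(maximalRealSubfield L)) L (IsCMField.complexConj L) 3).Adelic => ((η i (adelicVal (↥(maximalRealSubfield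 L)) L (IsCMField.complexConj L) 3 ((StdForm.antidiagonal 3).over L) x) : ℝ) : ℂ)) (fun x : (quasiSplit (↥(maximalRealSubfield L)) L (IsCMField.complexConj L) 3).Adelic => ((η i (adelicVal (↥(maximalRealSubfield L)) L (IsCMField.complexConj L) 3 ((StdForm.antidiagonal 3).over L) x) : ℝ) : ℂ)) y) g) ∧ (∀ g, conj ((fun y : (quasiSplit (↥(maximalRealSubfield L)) L (IsCMField.complexConj L) 3).Adelic => orbitalSmoothing νG (fun x : (quasiSplit (↥(maximalRealSubfield L)) L (IsCMField.complexConj L) 3).Adelic => ((η i (adelicVal (↥(maximalRealSubfield L)) L (IsCMField.complexConj L) 3 ((StdForm.antidiagonal 3).over L) x) : ℝ) : ℂ)) (fun x : (quasiSplit (↥(maximalRealSubfield L)) L (IsCMField.complexConj L) 3).Adelic => ((η i (adelicVal (↥(maximalRealSubfield L)) L (IsCMField.complexConj L) 3 ((StdForm.antidiagonal 3).over L) x) : ℝ) : ℂ)) y) g) = (fun y : (quasiSplit (↥(maximalRealSubfield L)) L (IsCMField.complexConj L) 3).Adelic => orbitalSmoothing νG (fun x : (quasiSplit (↥(maximalRealSubfield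 L)) L (IsCMField.complexConj L) 3).Adelic => ((η i (adelicVal (↥(maximalRealSubfield L)) L (IsCMField.complexConj L) 3 ((StdForm.antidiagonal 3).over L) x) : ℝ) : ℂ)) (fun x : (quasiSplit (↥(maximalRealSubfield L)) L (IsCMField.complexConj L) 3).Adelic => ((η i (adelicVal (↥(maximalRealSubfield L)) L (IsCMField.complexConj L) 3 ((StdForm.antidiagonal 3).over L) x) : ℝ) : ℂ)) y) g) ∧ (∀ g, 0 ≤ ((fun y : (quasiSplit (↥(maximalRealSubfield L)) L (IsCMField.complexConj L) 3).Adelic => orbitalSmoothing νG (fun x : (quasiSplit (↥(maximalRealSubfield L)) L (IsCMField.complexConj L) 3).Adelic => ((η i (adelicVal (↥(maximalRealSubfield L)) L (IsCMField.complexConj L) 3 ((StdForm.antidiagonal 3).over L) x) : ℝ) : ℂ)) (fun x : (quasiSplit (↥(maximalRealSubfield L)) L (IsCMField.complexConj L) 3).Adelic => ((η i (adelicVal (↥(maximalRealSubfield L)) L (IsCMField.complexConj L) 3 ((StdForm.antidiagonal 3).over L) x) : ℝ) : ℂ)) y) g).re)) ∧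
      -- the EIGENVALUE FUNCTIONS `ŝ_i` (entire), the scalar action of `h_i` on `V ⊗ H^z`, the cover of the ball, and the non-constant member `i₀`
      (∀ i, Differentiable ℂ (ŝ i)) ∧
      (∀ i, ∀ z : ℂ, ∀ φ ∈ V, ∀ x : (quasiSplit (↥(maximalRealSubfield L)) L (IsCMField.complexConj L) 3).Adelic, (∫ y, (fun y : (quasiSplit (↥(maximalRealSubfield L)) L (IsCMField.complexConj L) 3).Adelic => orbitalSmoothing νG (fun x : (quasiSplit (↥(maximalRealSubfield L)) L (IsCMField.complexConj L) 3).Adelic => ((η i (adelicVal (↥(maximalRealSubfield L)) L (IsCMField.complexConj L) 3 ((StdForm.antidiagonal 3).over L) x) : ℝ) : ℂ)) (fun x : (quasiSplit (↥(maximalRealSubfield L)) L (IsCMField.complexConj L) 3).Adelic => ((η i (adelicVal (↥(maximalRealSubfield L)) L (IsCMField.complexConj L) 3 ((StdForm.antidiagonal 3).over L) x) : ℝ) : ℂ)) y) y * flatSectionU φ z (x * y) ∂νG) = ŝ i z * flatSectionU φ z x) ∧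
      (∀ z ∈ Metric.ball (0 : ℂ) (n + 2), ∃ i, ŝ i z ≠ 0) ∧
      (∃ z₁ z₂ : ℂ, ŝ i₀ z₁ ≠ ŝ i₀ z₂) ∧ (∃ z ∈ Metric.ball (0 : ℂ) (n + 2), ŝ i₀ z ≠ 0) ∧
      (∀ i, 1 ≤ κ i ∧ a ≤ κ i * a) ∧
      (∀ i, ∀ z : borelQuotient (↥(maximalRealSubfield L)) L (IsCMField.complexConj L) 3, ∀ y ∈ tsupport (fun y : (quasiSplit (↥(maximalRealSubfield L)) L (IsCMField.complexConj L) 3).Adelic => orbitalSmoothing νG (fun x : (quasiSplit (↥(maximalRealSubfield L)) L (IsCMField.complexConj L) 3).Adelic => ((η i (adelicVal (↥(maximalRealSubfield L)) L (IsCMField.complexConj L) 3 ((StdForm.antidiagonal 3).over L) x) : ℝ) : ℂ)) (fun x : (quasiSplit (↥(maximalRealSubfield L)) L (IsCMField.complexConj L) 3).Adelic => ((η i (adelicVal (↥(maximalRealSubfield L)) L (IsCMField.complexConj L) 3 ((StdForm.antidiagonal 3).over L) x) : ℝ) : ℂ)) y), borelQuotHeight (↥(maximalRealSubfield L)) L (IsCMField.complexConj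 L) 3 z ≤ κ i * borelQuotHeight (↥(maximalRealSubfield L)) L (IsCMField.complexConj L) 3 (rightShift (↥(maximalRealSubfield L)) L (IsCMField.complexConj L) 3 y z)) ∧
      (∀ i, ∃ hpos : 0 < κ i * a, Function.Injective (iota (iotaBound_cm_three L μ νG hβ hμZ hpos (n + 4))) ∧
        IsClosed ((LinearMap.range (iota (iotaBound_cm_three L μ νG hβ hμZ hpos (n + 4))).toLinearMap :
          Submodule ℂ (HN (↥(maximalRealSubfield L)) L (IsCMField.complexConj L) 3 (n + 4) (κ i * a) μZ)) : Set (HN (↥(maximalRealSubfield L)) L (IsCMField.complexConj L) 3 (n + 4) (κ i * a) μZ))) ∧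
      μZ {z | a < borelQuotHeight (↥(maximalRealSubfield L)) L (IsCMField.complexConj L) 3 z} ≠ 0 ∧
      (∀ i, ∀ u : HX (↥(maximalRealSubfield L)) L (IsCMField.complexConj L) 3 (n + 4) μ,
        (T i u : (quasiSplit (↥(maximalRealSubfield L)) L (IsCMField.complexConj L) 3).automorphicQuotient → ℂ) =ᵐ[μ.withDensity fun x =>
            (((supHeight (↥(maximalRealSubfield L)) L (IsCMField.complexConj L) 3 x)⁻¹ ^ (2 * (n + 4)) : ℝ≥0) : ℝ≥0∞)]
          fun ξ => ∫ y, (fun y : (quasiSplit (↥(maximalRealSubfield L)) L (IsCMField.complexConj L) 3).Adelic => orbitalSmoothing νG (fun x : (quasiSplit (↥(maximalRealSubfield L)) L (IsCMField.complexConj L) 3).Adelic => ((η i (adelicVal (↥(maximalRealSubfield L)) L (IsCMField.complexConj L) 3 ((StdForm.antidiagonal 3).over L) x) : ℝ) : ℂ)) (fun x : (quasiSplit (↥(maximalRealSubfield L)) L (IsCMField.complexConj L) 3).Adelic => ((η i (adelicVal (↥(maximalRealSubfield L)) L (IsCMField.complexConj L) 3 ((StdForm.antidiagonal 3).over L) x)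 : ℝ) : ℂ)) y) y * (u : (quasiSplit (↥(maximalRealSubfield L)) L (IsCMField.complexConj L) 3).automorphicQuotient → ℂ) (y⁻¹ • ξ) ∂νG) ∧
      (∀ i, ∃ hs : ShiftBound (↥(maximalRealSubfield L)) L (IsCMField.complexConj L) 3 (n + 4) a (κ i * a) νG μZ (fun y : (quasiSplit (↥(maximalRealSubfield L)) L (IsCMField.complexConj L) 3).Adelic => orbitalSmoothing νG (fun x : (quasiSplit (↥(maximalRealSubfield L)) L (IsCMField.complexConj L) 3).Adelic => ((η i (adelicVal (↥(maximalRealSubfield L)) L (IsCMField.complexConj L) 3 ((StdForm.antidiagonal 3).over L) x) : ℝ) : ℂ)) (fun x : (quasiSplit (↥(maximalRealSubfield L)) L (IsCMField.complexConj L) 3).Adelic => ((η i (adelicVal (↥(maximalRealSubfield L)) L (IsCMField.complexConj L) 3 ((StdForm.antidiagonal 3).over L) x) : ℝ) : ℂ)) y),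
        ∀ (h01 : a ≤ κ i * a),
          deltaShift hs ∘L iota (iotaBound_cm_three L μ νG hβ hμZ ha (n + 4)) =
            restrHN (↥(maximalRealSubfield L)) L (IsCMField.complexConj L) 3 (n + 4) h01 μZ ∘L iota (iotaBound_cm_three L μ νG hβ hμZ ha (n + 4)) ∘L T i) := by
  classical
  have hemb : Topology.IsClosedEmbedding ⇑(adelicVal (↥(maximalRealSubfield L)) L (IsCMField.complexConj L) 3 ((StdForm.antidiagonal 3).over L)) :=
    (isClosed_adelic (↥(maximalRealSubfield L)) L (IsCMField.complexConj L) 3 ((StdForm.antidiagonal 3).over L)).isClosedEmbedding_subtypeVal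
  -- ── the combined family over `Option ℂ`: `none ↦` the `hnc` member, `some z₀ ↦` the `hfam` member at `z₀` ──
  choose ηf hηft hηf0 hηfsymm sf hsfd hsf0 hactf using hfam
  obtain ⟨η₀, hη₀t, hη₀0, hη₀symm, s₀, hs₀d, hs₀nc, hact₀⟩ := hnc
  obtain ⟨ηC, hηC⟩ : ∃ ηC : Option ℂ → GL (Fin 3) (AdeleRing (𝓞 L) L) → ℝ, ηC = fun o => Option.elim o η₀ ηf := ⟨_, rfl⟩
  obtain ⟨sC, hsC⟩ : ∃ sC : Option ℂ → ℂ → ℂ, sC = fun o => Option.elim o s₀ sf := ⟨_, rfl⟩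
  have hCt : ∀ o, IsTestFunctionGL 3 L (ηC o) := by rintro (_ | z₀) <;> simp only [hηC, Option.elim] <;> [exact hη₀t; exact hηft z₀]
  have hC0 : ∀ o g, 0 ≤ ηC o g := by rintro (_ | z₀) g <;> simp only [hηC, Option.elim] <;> [exact hη₀0 g; exact hηf0 z₀ g]
  have hCsymm : ∀ o g, ηC o g⁻¹ = ηC o g := by rintro (_ | z₀) g <;> simp only [hηC, Option.elim] <;> [exact hη₀symm g; exact hηfsymm z₀ g]
  have hCd : ∀ o, Differentiable ℂ (sC o) := by rintro (_ | z₀) <;> simp only [hsC, Option.elim] <;> [exact hs₀d; exact hsfd z₀]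
  have hCact : ∀ o, ∀ z : ℂ, ∀ φ ∈ V, ∀ x : (quasiSplit (↥(maximalRealSubfield L)) L (IsCMField.complexConj L) 3).Adelic, (∫ y, (fun y : (quasiSplit (↥(maximalRealSubfield L)) L (IsCMField.complexConj L) 3).Adelic => orbitalSmoothing νG (fun x : (quasiSplit (↥(maximalRealSubfield L)) L (IsCMField.complexConj L) 3).Adelic => ((ηC o (adelicVal (↥(maximalRealSubfield L)) L (IsCMField.complexConj L) 3 ((StdForm.antidiagonal 3).over L) x) : ℝ) : ℂ)) (fun x : (quasiSplit (↥(maximalRealSubfield L)) L (IsCMField.complexConj L) 3).Adelic => ((ηC o (adelicVal (↥(maximalRealSubfield L)) L (IsCMField.complexConj L) 3 ((StdForm.antidiagonal 3).over L) x) : ℝ) : ℂ)) y) y * flatSectionU φ z (x * y) ∂νG) = sC o z * flatSectionU φ z x := by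
    rintro (_ | z₀) <;> simp only [hηC, hsC, Option.elim] <;> [exact hact₀; exact hactf z₀]
  have hCcov : ∀ z : ℂ, ∃ o, sC o z ≠ 0 := fun z => ⟨some z, by simp only [hsC, Option.elim]; exact hsf0 z⟩
  -- finitely many members cover the closed ball (the `ŝ` are entire, hence continuous)
  obtain ⟨s, hs⟩ := exists_finset_forall_exists_ne_zero_closedBall (fun o => (hCd o).continuous) hCcov ((n : ℝ) + 2)
  -- the index type `Option s` (`none ↦` the non-constant member) and the reindexing `r`
  obtain ⟨r, hr⟩ : ∃ r : Option ↥s → Option ℂ, r = fun o => Option.elim o none fun j : ↥s => (j : Option ℂ) := ⟨_, rfl⟩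
  have hrn : r none = none := by rw [hr]; rfl
  have hrs : ∀ j : ↥s, r (some j) = (j : Option ℂ) := fun j => by rw [hr]; rfl
  obtain ⟨ηI, hηI⟩ : ∃ ηI : Option ↥s → GL (Fin 3) (AdeleRing (𝓞 L) L) → ℝ, ηI = fun o => ηC (r o) := ⟨_, rfl⟩
  obtain ⟨ŝ, hŝ⟩ : ∃ ŝ : Option ↥s → ℂ → ℂ, ŝ = fun o => sC (r o) := ⟨_, rfl⟩
  have hηIo : ∀ o, ηI o = ηC (r o) := fun o => by rw [hηI]
  have hŝo : ∀ o, ŝ o = sC (r o) := fun o => by rw [hŝ]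
  -- properties of the lifts and of their self-convolutions (★ `K2E1BLSelfConvolutionU2`)
  have hIt : ∀ o, IsTestFunctionGL 3 L (ηI o) := fun o => by rw [hηIo]; exact hCt (r o)
  have hI0 : ∀ o g, 0 ≤ ηI o g := fun o g => by rw [hηIo]; exact hC0 (r o) g
  have hLc : ∀ o, Continuous (fun x : (quasiSplit (↥(maximalRealSubfield L)) L (IsCMField.complexConj L) 3).Adelic => ((ηI o (adelicVal (↥(maximalRealSubfield L)) L (IsCMField.complexConj L) 3 ((StdForm.antidiagonal 3).over L) x) : ℝ) : ℂ)) := fun o => continuous_lift (hIt o).continuous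
  have hLs : ∀ o, HasCompactSupport (fun x : (quasiSplit (↥(maximalRealSubfield L)) L (IsCMField.complexConj L) 3).Adelic => ((ηI o (adelicVal (↥(maximalRealSubfield L)) L (IsCMField.complexConj L) 3 ((StdForm.antidiagonal 3).over L) x) : ℝ) : ℂ)) := fun o => hasCompactSupport_lift (hIt o).hasCompactSupport
  have hLsymm : ∀ o (g : (quasiSplit (↥(maximalRealSubfield L)) L (IsCMField.complexConj L) 3).Adelic), (fun x : (quasiSplit (↥(maximalRealSubfield L)) L (IsCMField.complexConj L) 3).Adelic => ((ηI o (adelicVal (↥(maximalRealSubfield L)) L (IsCMField.complexConj L) 3 ((StdForm.antidiagonal 3).over L) x) : ℝ) : ℂ)) g⁻¹ = (fun x : (quasiSplit (↥(maximalRealSubfield L)) L (IsCMField.complexConj L) 3).Adelic => ((ηI o (adelicVal (↥(maximalRealSubfield L)) L (IsCMField.complexConj L) 3 ((StdForm.antidiagonal 3).over L) x) : ℝ) : ℂ)) g := fun o g => by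
    simp only [map_inv, hηIo, hCsymm]
  have hLreal : ∀ o (g : (quasiSplit (↥(maximalRealSubfield L)) L (IsCMField.complexConj L) 3).Adelic), conj ((fun x : (quasiSplit (↥(maximalRealSubfield L)) L (IsCMField.complexConj L) 3).Adelic => ((ηI o (adelicVal (↥(maximalRealSubfield L)) L (IsCMField.complexConj L) 3 ((StdForm.antidiagonal 3).over L) x) : ℝ) : ℂ)) g) = (fun x : (quasiSplit (↥(maximalRealSubfield L)) L (IsCMField.complexConj L) 3).Adelic => ((ηI o (adelicVal (↥(maximalRealSubfield L)) L (IsCMField.complexConj L) 3 ((StdForm.antidiagonal 3).over L) x) : ℝ) : ℂ)) g := fun o g => Complex.conj_ofReal _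
  -- Hecke packages of the self-convolutions (★, comparison exported)
  haveI : νG.IsMulRightInvariant := by rw [← Measure.inv_eq_self νG]; infer_instance
  have hright := measurePreserving_rightShift_of_unfolding νG hβ hμZ
  have hpk : ∀ o : Option ↥s, ∃ κ : ℝ≥0, 1 ≤ κ ∧
      (∀ z : borelQuotient (↥(maximalRealSubfield L)) L (IsCMField.complexConj L) 3, ∀ y ∈ tsupport (fun y : (quasiSplit (↥(maximalRealSubfield L)) L (IsCMField.complexConj L) 3).Adelic => orbitalSmoothing νG (fun x : (quasiSplit (↥(maximalRealSubfield L)) L (IsCMField.complexConj L) 3).Adelic => ((ηI o (adelicVal (↥(maximalRealSubfield L)) L (IsCMField.complexConj L) 3 ((StdForm.antidiagonal 3).over L) x) : ℝ) : ℂ)) (fun x : (quasiSplit (↥(maximalRealSubfield L)) L (IsCMField.complexConj L) 3).Adelic => ((ηI o (adelicVal (↥(maximalRealSubfield L)) L (IsCMField.complexConj L) 3 ((StdForm.antidiagonal 3).over L) x) : ℝ) : ℂ)) y),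
          borelQuotHeight (↥(maximalRealSubfield L)) L (IsCMField.complexConj L) 3 z ≤ κ * borelQuotHeight (↥(maximalRealSubfield L)) L (IsCMField.complexConj L) 3 (rightShift (↥(maximalRealSubfield L)) L (IsCMField.complexConj L) 3 y z)) ∧
      ∃ T : HX (↥(maximalRealSubfield L)) L (IsCMField.complexConj L) 3 (n + 4) μ →L[ℂ] HX (↥(maximalRealSubfield L)) L (IsCMField.complexConj L) 3 (n + 4) μ,
      (∀ u : HX (↥(maximalRealSubfield L)) L (IsCMField.complexConj L) 3 (n + 4) μ, (T u : (quasiSplit (↥(maximalRealSubfield L)) L (IsCMField.complexConj L) 3).automorphicQuotient → ℂ) =ᵐ[μ.withDensity fun x =>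
            (((supHeight (↥(maximalRealSubfield L)) L (IsCMField.complexConj L) 3 x)⁻¹ ^ (2 * (n + 4)) : ℝ≥0) : ℝ≥0∞)]
          fun ξ => ∫ y, (fun y : (quasiSplit (↥(maximalRealSubfield L)) L (IsCMField.complexConj L) 3).Adelic => orbitalSmoothing νG (fun x : (quasiSplit (↥(maximalRealSubfield L)) L (IsCMField.complexConj L) 3).Adelic => ((ηI o (adelicVal (↥(maximalRealSubfield L)) L (IsCMField.complexConj L) 3 ((StdForm.antidiagonal 3).over L) x) : ℝ) : ℂ)) (fun x : (quasiSplit (↥(maximalRealSubfield L)) L (IsCMField.complexConj L) 3).Adelic => ((ηI o (adelicVal (↥(maximalRealSubfield L)) L (IsCMField.complexConj L) 3 ((StdForm.antidiagonal 3).over L) x) : ℝ) : ℂ)) y) y *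
            (u : (quasiSplit (↥(maximalRealSubfield L)) L (IsCMField.complexConj L) 3).automorphicQuotient → ℂ) (y⁻¹ • ξ) ∂νG) ∧
      ∀ (c₁ c₀ : ℝ≥0) (h01 : c₁ ≤ c₀), κ * c₁ ≤ c₀ → ∃ hs : ShiftBound (↥(maximalRealSubfield L)) L (IsCMField.complexConj L) 3 (n + 4) c₁ c₀ νG μZ
          (fun y : (quasiSplit (↥(maximalRealSubfield L)) L (IsCMField.complexConj L) 3).Adelic => orbitalSmoothing νG (fun x : (quasiSplit (↥(maximalRealSubfield L)) L (IsCMField.complexConj L) 3).Adelic => ((ηI o (adelicVal (↥(maximalRealSubfield L)) L (IsCMField.complexConj L) 3 ((StdForm.antidiagonal 3).over L) x) : ℝ) : ℂ)) (fun x : (quasiSplit (↥(maximalRealSubfield L)) L (IsCMField.complexConj L) 3).Adelic => ((ηI o (adelicVal (↥(maximalRealSubfield L)) L (IsCMField.complexConj L) 3 ((StdForm.antidiagonal 3).over L) x) : ℝ) : ℂ)) y),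
        ∀ hb : IotaBound (↥(maximalRealSubfield L)) L (IsCMField.complexConj L) 3 (n + 4) c₁ μ μZ,
          deltaShift hs ∘L iota hb = restrHN (↥(maximalRealSubfield L)) L (IsCMField.complexConj L) 3 (n + 4) h01 μZ ∘L iota hb ∘L T := fun o =>
    exists_heckePackage' νG μ μZ hright (continuous_selfConv νG (hLc o) (hLs o)) (hasCompactSupport_selfConv νG (hLs o))
      (integrable_selfConv νG νG (hLc o) (hLs o)) (n + 4)
  choose κ hκ hcmp T hT hpack using hpk
  -- thresholds and levels
  obtain ⟨c₁, hc₁, hι⟩ := exists_pos_iota_closedEmbedding_cm_three L μ νG hβ hμZ (n + 4)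
  obtain ⟨c₂, hc₂, hne⟩ := exists_pos_forall_measure_setOf_lt_ne_zero_cm_three L μ νG hβ hμZ (n + 4)
  obtain ⟨a, ha, hac, hlev⟩ := exists_levels κ hκ (lt_min hc₁ hc₂)
  -- the non-constant member `i₀ = none`: non-constant, hence non-zero somewhere in the (open, non-empty) ball (identity principle for entire functions)
  have hŝn : ŝ none = s₀ := by rw [hŝo, hrn, hsC]; rfl
  have hnc' : ∃ z₁ z₂ : ℂ, ŝ none z₁ ≠ ŝ none z₂ := by rw [hŝn]; exact hs₀nc
  have hball0 : ∃ z ∈ Metric.ball (0 : ℂ) (n + 2), ŝ none z ≠ 0 := by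
    by_contra hcon
    have hcon' : ∀ z ∈ Metric.ball (0 : ℂ) ((n : ℝ) + 2), ŝ none z = 0 := fun z hz => not_not.1 fun h => hcon ⟨z, hz, h⟩
    obtain ⟨z₁, z₂, hz⟩ := hnc'
    have hD : IsOpen (Metric.ball (0 : ℂ) ((n : ℝ) + 2)) := Metric.isOpen_ball
    have h0 : (0 : ℂ) ∈ Metric.ball (0 : ℂ) ((n : ℝ) + 2) := Metric.mem_ball_self (by positivity)
    have hs₀d' : Differentiable ℂ (ŝ none) := by rw [hŝn]; exact hs₀d
    have han : AnalyticOnNhd ℂ (ŝ none) univ := fun z _ => hs₀d'.analyticAt z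
    have hev : ∀ᶠ w in 𝓝 (0 : ℂ), ŝ none w = 0 := Filter.eventually_of_mem (hD.mem_nhds h0) fun w hw => hcon' w hw
    have hzero := han.eqOn_zero_of_preconnected_of_eventuallyEq_zero isPreconnected_univ (mem_univ 0) hev
    exact hz ((hzero (mem_univ z₁)).trans (hzero (mem_univ z₂)).symm)
  refine ⟨a, ha, Option ↥s, inferInstance, none, ηI, κ, T, ŝ, fun o => ?_, fun o => ?_, fun o => ?_, fun o => ?_, fun z hz => ?_, hnc', hball0,
    fun o => ⟨hκ o, (hlev o).1⟩, hcmp, fun o => ?_, hne a ha (hac.trans_le (min_le_right _ _)), hT, fun o => ?_⟩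
  · rw [hηIo]; exact ⟨hCt (r o), hC0 (r o), hCsymm (r o)⟩
  · exact ⟨continuous_selfConv νG (hLc o) (hLs o), hasCompactSupport_selfConv νG (hLs o), fun g => selfConv_inv νG (hLsymm o) g, fun g => conj_selfConv νG (hLreal o) g,
      fun g => selfConv_re_nonneg νG (hI0 o <| adelicVal (↥(maximalRealSubfield L)) L (IsCMField.complexConj L) 3 ((StdForm.antidiagonal 3).over L) ·) g⟩
  · rw [hŝo]; exact hCd (r o)
  · intro z φ hφ x
    have h := hCact (r o) z φ hφ x
    simp only [← hηIo] at h
    rw [hŝo]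
    exact h
  · obtain ⟨j, hjs, hj⟩ := hs z (Metric.ball_subset_closedBall hz)
    exact ⟨some ⟨j, hjs⟩, by rw [hŝo, hrs]; exact hj⟩
  · have hpos : 0 < κ o * a := lt_of_lt_of_le ha (hlev o).1
    obtain ⟨-, hinj, hcl⟩ := hι (κ o * a) hpos ((hlev o).2.trans_le (min_le_left _ _))
    exact ⟨hpos, hinj, hcl⟩
  · obtain ⟨hs', hδι⟩ := hpack o a (κ o * a) (hlev o).1 le_rfl
    exact ⟨hs', fun h01 => hδι (iotaBound_cm_three L μ νG hβ hμZ ha (n + 4))⟩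

end Summit.HodgeConjecture.HodgeConjecture.Cruxes.H413.K2E1ChiConvDataCMThree

end
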